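import Mathlib

/-!
# Beta/AffineAveraging — affine lattice one-forms: constant curvature, constant codifferential, and the
# straight-contour block sum (an2 item 12′)

HONEST FRAMING (cell `pub-balaban`, β sub-cell, row BETA-an2, node BETA-an2-AFFINE-AVERAGING).  The β sub-cell
tries to discharge the one-loop input `BetaPertH` of [Balaban1987RG1] Theorem 2; discharging it would make
Bałaban's ultraviolet STABILITY theorem unconditional — a real constructive-QFT result, but NOT the continuum limit
and NOT the Clay Millennium problem.  This file is far less than that: ELEMENTARY FINITE-DIFFERENCE ALGEBRA for
functions on the lattice `ℤ^d` with values in an arbitrary commutative ring.  Value = kernel certificate of the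
«elementary» half of one typed residual, NOT summit progress.  ABSOLUTE RULE of the cell: nothing of the manuscripts
under audit is used as a fact; the Bałaban references below are CONTEXT LOCATORS only; every theorem here is
[folklore]-level algebra.

CONTEXT (why the cell wants this; nothing of it is asserted in Lean).  The companion module `Beta/DecimatedMoment`
proves that dressing a lattice kernel `T` by translation-covariant coarse→fine maps and decimating does not change its
second moment (up to mass factors) PROVIDED the response patterns reproduce constants and coordinate functions exactly
(its hypotheses (L0), (L1), (R0)).  In the cell's reading of [Balaban1987RG1] p. 270 (3.3) and pp. 265–266 (2.6), the
pattern in question is, at the trivial background, the linear constrained minimiser `H` of [Balaban1985Variational]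
p. 285 (45) — «an operator defined on configurations B and giving a minimum of the quadratic form ½⟨A, ΔA⟩ under the
restrictions L^jηQ_jA = B …, RD*A = 0» — composed with linear block averaging of one-forms along straight contours
([Balaban1984PropagatorsI] p. 19 (1.11) «(QA)_c = Σ_{x∈B(c₋)} L^{−(d+1)} A([x, x(c)])»), where `R` is «an orthogonal
projection … onto the subspace Δ_U N(Q′), N(Q′) = {λ : Q′λ = 0}» ([Balaban1985BackgroundPropagators] p. 394 (3.21)).
The cell's typed claim (record `HOME/BETA/AN2.md` §11 (Y10), labelled (KKT-alg)) is that EVERY AFFINE one-form is a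
Karush–Kuhn–Tucker point of that constrained problem for its own (affine) averaged data: its curvature is constant, so
the Euler–Lagrange term vanishes; its codifferential is constant, so any gauge projector annihilating constants
annihilates it; and the averaged data are again affine.  Whether the minimiser is UNIQUE in a class containing affine
forms (the cell's (Liouville-KKT), an analytic statement) is NOT touched here.  THIS FILE kernel-checks exactly the
three algebraic facts, for plain functions on `ℤ^d` (no finiteness, no torus), over any `CommRing`.

WHAT THIS FILE PROVES (all [folklore]; `R` any `CommRing`; sites `Site d = Fin d → ℤ`; `unitVec κ = Pi.single κ 1`;
0-, 1-, 2-forms = plain functions `Site d → R`, `Fin d → Site d → R`, `Fin d → Fin d → Site d → R`):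
* §1 operators: `dz f κ x = f (x + e_κ) − f x`; `curv A κ l x = A κ x + A l (x + e_κ) − A κ (x + e_l) − A l x` (lattice
  curvature on ALL ordered pairs, `curv A κ κ = 0`); `curvAdj F` = the FORMAL ADJOINT of `curv` for the pairing
  `Σ_{κ,l,x}` (displayed in its docstring; so `curvAdj (curv A)` is the Euler–Lagrange operator of `½ Σ |curv A|²`);
  `codiff₁ A x = Σ_κ (A κ (x − e_κ) − A κ x)` (minus the lattice divergence); `curv_dz : curv (dz f) = 0`;
  `curvAdj_const : curvAdj (fun κ l _ => F κ l) = 0`.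
* §2 affine one-forms `affine m c κ x = Σ_l m κ l · x_l + c κ` (`m` any matrix, `c` any vector over `R`):
  `affine_apply_add_unitVec / _sub_unitVec / _smul_add` (evaluation rules); `curv_affine : curv (affine m c) κ l x =
  m l κ − m κ l` (CONSTANT curvature); `curvAdj_curv_affine : curvAdj (curv (affine m c)) = 0` (zero Euler–Lagrange
  term — stationarity with ZERO multipliers); `codiff₁_affine : codiff₁ (affine m c) x = −Σ_κ m κ κ` (CONSTANT);
  `gauge_constraint_affine : (∀ t, Rop (fun _ => t) = 0) → Rop (codiff₁ (affine m c)) = 0` for ANY operator `Rop` on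
  0-forms annihilating constants.
* §3 block sums (`box d L` = `{0,…,L−1}^d`, of cardinality `L^d`; UNNORMALISED sums, so no division is needed):
  `blockSum L f y = Σ_{b∈box} f (L•y + b)` (scalar block sum = L^d × block mean); `contourSum L A κ y = Σ_{b∈box}
  Σ_{s<L} A κ (L•y + b + s•e_κ)` (= L^{d+1} × the straight-contour average (1.11) at unit background);
  `contourSum_dz : contourSum L (dz f) = dz (blockSum L f)` (averaging INTERTWINES the exterior derivative — the
  linearised gauge covariance: exact fine data give exact coarse data); `contourSum_affine : contourSum L (affine m c)
  = affine ((L^(d+2) : ℕ) • m) (fun κ => contourSum L (affine m c) κ 0)` (affine ↦ affine, linear part scaled by the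
  non-zero-for-L≠0 factor `L^(d+2)` = L^d points × L bonds × L from `x = L•y`).
* §4 `affine_KKT` — the three facts bundled: for every `m`, `c`, `L` and every `Rop` killing constants,
  `curvAdj (curv (affine m c)) = 0 ∧ Rop (codiff₁ (affine m c)) = 0 ∧ contourSum L (affine m c) = affine (L^(d+2) • m) _`.
* §5 kernel witnesses by `decide` over `ℤ`: `witness_EL_nonzero` — for the quadratic (non-affine) 1-form `A₀ = x₁²`
  on `ℤ²` the Euler–Lagrange term is `−4 ≠ 0` (§2 is not vacuous); `example_contourSum` — `d = 1`, `L = 2`, `m = 3`,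
  `c = 5`: contour sums `56` at `y = 1` and `32` at `y = 0` (`56 − 32 = 24 = L^(d+2)·m`).

WHAT THIS FILE DOES NOT CLAIM.  (i) Nothing about minimisers: that an affine form IS the (unique) solution of the
constrained problem for its data needs uniqueness in a class of polynomially bounded configurations on `ℤ^d` — an
ANALYTIC statement (cell label (Liouville-KKT)) not formalised here.  (ii) No identification of `curv`, `codiff₁`,
`contourSum`, `Rop` with the operators of the manuscripts beyond the displayed formulas; in particular the manuscripts'
multi-level constraints, Dirichlet regions, `η`-scalings `L^{−(d+1)}`, `L^jη`, non-abelian structure and non-trivial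
backgrounds are absent (at the trivial background the linearised operators are colour-diagonal copies of these).
(iii) No statement of [Balaban1987RG1], [Balaban1985Variational], [Balaban1984PropagatorsI],
[Balaban1985BackgroundPropagators] is used or asserted; the citations are LOCATORS for the reader of the cell record.

Straightforward finite-difference algebra [folklore]; no mathematical content beyond the evaluation of affine
functions at shifted lattice points and a telescoping sum.
-/

namespace Literature.MathematicalPhysics.QuantumFieldTheory.Balaban1983to89.Beta.AffineAveraging

open Finset

variable {d : ℕ} {R : Type*} [CommRing R]

/-! ## §1 Lattice sites, forms, finite-difference operators -/

/-- [folklore] Lattice sites of `ℤ^d`. -/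
abbrev Site (d : ℕ) : Type := Fin d → ℤ

/-- [folklore] 0-forms (scalar lattice functions). -/
abbrev Form0 (d : ℕ) (R : Type*) : Type _ := Site d → R

/-- [folklore] 1-forms: a value per direction `κ` and base point `x` (the bond `[x, x + e_κ]`). -/
abbrev Form1 (d : ℕ) (R : Type*) : Type _ := Fin d → Site d → R

/-- [folklore] 2-forms on ALL ordered pairs of directions (no antisymmetry imposed). -/
abbrev Form2 (d : ℕ) (R : Type*) : Type _ := Fin d → Fin d → Site d → R

/-- [folklore] The unit lattice vector `e_κ`. -/
def unitVec (κ : Fin d) : Site d := Pi.single κ 1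

/-- [folklore] Components of `e_κ`. -/
@[simp] theorem unitVec_apply (κ l : Fin d) : unitVec κ l = if l = κ then 1 else 0 := by
  simp [unitVec, Pi.single_apply]

/-- [folklore] Exterior derivative on 0-forms: `(dz f)_κ(x) = f(x + e_κ) − f(x)`. -/
def dz (f : Form0 d R) : Form1 d R := fun κ x => f (x + unitVec κ) - f x

/-- [folklore] Lattice curvature (exterior derivative on 1-forms), on all ordered pairs `(κ, l)`:
`(curv A)_{κl}(x) = A_κ(x) + A_l(x + e_κ) − A_κ(x + e_l) − A_l(x)`. -/
def curv (A : Form1 d R) : Form2 d R :=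
  fun κ l x => A κ x + A l (x + unitVec κ) - A κ (x + unitVec l) - A l x

/-- [folklore] The FORMAL ADJOINT of `curv` for the pairing `Σ_{κ,l,x} (curv A)_{κl}(x) · F_{κl}(x)`: collecting the
coefficient of `A_μ(y)` in that pairing gives
`(curvAdj F)_μ(y) = Σ_l (F_{μl}(y) − F_{μl}(y − e_l)) + Σ_κ (F_{κμ}(y − e_κ) − F_{κμ}(y))`.
Hence `curvAdj (curv A)` is the Euler–Lagrange operator of the quadratic form `½ Σ |curv A|²`. -/
def curvAdj (F : Form2 d R) : Form1 d R :=
  fun μ y => (∑ l, (F μ l y - F μ l (y - unitVec l))) + ∑ κ, (F κ μ (y - unitVec κ) - F κ μ y)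

/-- [folklore] Codifferential on 1-forms (minus the lattice divergence): `Σ_κ (A_κ(x − e_κ) − A_κ(x))`. -/
def codiff₁ (A : Form1 d R) : Form0 d R := fun x => ∑ κ, (A κ (x - unitVec κ) - A κ x)

/-- [folklore] `d ∘ d = 0`: exact 1-forms have zero curvature. -/
theorem curv_dz (f : Form0 d R) : curv (dz f) = 0 := by
  funext κ l x
  simp only [curv, dz, Pi.zero_apply]
  have h : x + unitVec κ + unitVec l = x + unitVec l + unitVec κ := by abel
  rw [h]; abel

/-- [folklore] A 2-form constant in `x` has zero formal co-derivative. -/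
theorem curvAdj_const (F : Fin d → Fin d → R) : curvAdj (fun κ l (_ : Site d) => F κ l) = 0 := by
  funext μ y
  simp [curvAdj]

/-! ## §2 Affine one-forms -/

/-- [folklore] The affine 1-form with linear part `m` (any `d × d` matrix over `R`) and constant part `c`:
`A_κ(x) = Σ_l m κ l · x_l + c κ`. -/
def affine (m : Fin d → Fin d → R) (c : Fin d → R) : Form1 d R :=
  fun κ x => (∑ l, m κ l * (x l : R)) + c κ

/-- [folklore] Evaluation at a shifted point: `A_κ(x + e_μ) = A_κ(x) + m κ μ`. -/
theorem affine_apply_add_unitVec (m : Fin d → Fin d → R) (c : Fin d → R) (κ μ : Fin d) (x : Site d) :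
    affine m c κ (x + unitVec μ) = affine m c κ x + m κ μ := by
  have h : ∀ l, m κ l * (((x + unitVec μ) l : ℤ) : R) = m κ l * (x l : R) + (if l = μ then m κ l else 0) := by
    intro l
    simp only [Pi.add_apply, unitVec_apply, Int.cast_add, Int.cast_ite, Int.cast_one, Int.cast_zero]
    split_ifs <;> ring
  simp only [affine, h, Finset.sum_add_distrib, Finset.sum_ite_eq', Finset.mem_univ, if_true]
  ring

/-- [folklore] Evaluation at a backward-shifted point: `A_κ(x − e_μ) = A_κ(x) − m κ μ`. -/
theorem affine_apply_sub_unitVec (m : Fin d → Fin d → R) (c : Fin d → R) (κ μ : Fin d) (x : Site d) :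
    affine m c κ (x - unitVec μ) = affine m c κ x - m κ μ := by
  have h := affine_apply_add_unitVec m c κ μ (x - unitVec μ)
  rw [sub_add_cancel] at h
  rw [h]; ring

/-- [folklore] Evaluation at `L • y + z`: the linear part picks up `L · Σ_l m κ l · y_l`. -/
theorem affine_apply_smul_add (m : Fin d → Fin d → R) (c : Fin d → R) (κ : Fin d) (L : ℤ) (y z : Site d) :
    affine m c κ (L • y + z) = (L : R) * (∑ l, m κ l * (y l : R)) + affine m c κ z := by
  have h : ∀ l, m κ l * (((L • y + z) l : ℤ) : R) = (L : R) * (m κ l * (y l : R)) + m κ l * (z l : R) := by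
    intro l
    simp only [Pi.add_apply, Pi.smul_apply, smul_eq_mul, Int.cast_add, Int.cast_mul]
    ring
  simp only [affine, h, Finset.sum_add_distrib, ← Finset.mul_sum]
  ring

/-- [folklore] CONSTANT CURVATURE of an affine 1-form: `(curv A)_{κl} = m l κ − m κ l`. -/
theorem curv_affine (m : Fin d → Fin d → R) (c : Fin d → R) (κ l : Fin d) (x : Site d) :
    curv (affine m c) κ l x = m l κ - m κ l := by
  simp only [curv, affine_apply_add_unitVec]
  ring

/-- [folklore] The curvature of an affine 1-form as a constant 2-form. -/
theorem curv_affine_eq (m : Fin d → Fin d → R) (c : Fin d → R) :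
    curv (affine m c) = fun κ l (_ : Site d) => m l κ - m κ l := by
  funext κ l x
  exact curv_affine m c κ l x

/-- [folklore] ZERO EULER–LAGRANGE TERM: an affine 1-form is a stationary point of `½ Σ |curv A|²` with zero
multipliers — the formal co-derivative of its (constant) curvature vanishes. -/
theorem curvAdj_curv_affine (m : Fin d → Fin d → R) (c : Fin d → R) :
    curvAdj (curv (affine m c)) = 0 := by
  rw [curv_affine_eq]
  exact curvAdj_const _

/-- [folklore] CONSTANT CODIFFERENTIAL of an affine 1-form: `codiff₁ A = −tr m`. -/
theorem codiff₁_affine (m : Fin d → Fin d → R) (c : Fin d → R) (x : Site d) :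
    codiff₁ (affine m c) x = -∑ κ, m κ κ := by
  simp only [codiff₁, affine_apply_sub_unitVec, ← Finset.sum_neg_distrib]
  refine Finset.sum_congr rfl fun κ _ => ?_
  ring

/-- [folklore] The codifferential of an affine 1-form as a constant function. -/
theorem codiff₁_affine_eq (m : Fin d → Fin d → R) (c : Fin d → R) :
    codiff₁ (affine m c) = fun (_ : Site d) => -∑ κ, m κ κ := by
  funext x
  exact codiff₁_affine m c x

/-- [folklore] GAUGE CONSTRAINT: any operator on 0-forms that annihilates constant functions annihilates the
codifferential of every affine 1-form. -/
theorem gauge_constraint_affine (Rop : Form0 d R → Form0 d R) (hR : ∀ t : R, Rop (fun _ => t) = 0)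
    (m : Fin d → Fin d → R) (c : Fin d → R) : Rop (codiff₁ (affine m c)) = 0 := by
  rw [codiff₁_affine_eq]
  exact hR _

/-! ## §3 Block sums and the straight-contour sum -/

/-- [folklore] The block of offsets `{0, …, L−1}^d`. -/
def box (d L : ℕ) : Finset (Fin d → ℕ) := Fintype.piFinset fun _ => Finset.range L

/-- [folklore] An offset as a lattice site. -/
def toSite (b : Fin d → ℕ) : Site d := fun i => (b i : ℤ)

/-- [folklore] Scalar block sum: `Σ_{b ∈ box} f (L•y + b)` (`L^d` times the block mean). -/
def blockSum (L : ℕ) (f : Form0 d R) : Form0 d R :=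
  fun y => ∑ b ∈ box d L, f ((L : ℤ) • y + toSite b)

/-- [folklore] Straight-contour block sum of a 1-form: `Σ_{b ∈ box} Σ_{s<L} A_κ (L•y + b + s•e_κ)` — the sum of `A`
along the straight contour of `L` bonds in direction `κ` starting at each point of the block (`L^{d+1}` times the
straight-contour average). -/
def contourSum (L : ℕ) (A : Form1 d R) : Form1 d R :=
  fun κ y => ∑ b ∈ box d L, ∑ s ∈ Finset.range L, A κ ((L : ℤ) • y + toSite b + (s : ℤ) • unitVec κ)

/-- [folklore] The contour sum of an exact form telescopes (one block). -/
theorem sum_range_dz (f : Form0 d R) (κ : Fin d) (z : Site d) (L : ℕ) :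
    ∑ s ∈ Finset.range L, dz f κ (z + (s : ℤ) • unitVec κ) = f (z + (L : ℤ) • unitVec κ) - f z := by
  have h : ∀ s : ℕ, dz f κ (z + (s : ℤ) • unitVec κ)
      = f (z + ((s + 1 : ℕ) : ℤ) • unitVec κ) - f (z + (s : ℤ) • unitVec κ) := by
    intro s
    simp only [dz, Nat.cast_add, Nat.cast_one, add_smul, one_smul, add_assoc]
  simp only [h]
  rw [Finset.sum_range_sub (fun s => f (z + (s : ℤ) • unitVec κ)) L]
  simp

/-- [folklore] AVERAGING INTERTWINES THE EXTERIOR DERIVATIVE (linearised gauge covariance): the straight-contour sum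
of `dz f` is `dz` (on the coarse lattice) of the block sum of `f`. -/
theorem contourSum_dz (L : ℕ) (f : Form0 d R) : contourSum L (dz f) = dz (blockSum L f) := by
  funext κ y
  simp only [contourSum, dz, blockSum, ← Finset.sum_sub_distrib]
  refine Finset.sum_congr rfl fun b _ => ?_
  have h := sum_range_dz f κ ((L : ℤ) • y + toSite b) L
  simp only [dz] at h
  rw [h, smul_add]
  congr 2
  abel

/-- [folklore] The straight-contour sum of an affine 1-form, pointwise: linear part scaled by `L^d · L · L`. -/
theorem contourSum_affine_apply (L : ℕ) (m : Fin d → Fin d → R) (c : Fin d → R) (κ : Fin d) (y : Site d) :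
    contourSum L (affine m c) κ y
      = ((L ^ d * L : ℕ) : R) * ((L : R) * ∑ l, m κ l * (y l : R)) + contourSum L (affine m c) κ 0 := by
  have key : ∀ (b : Fin d → ℕ) (s : ℕ),
      affine m c κ ((L : ℤ) • y + toSite b + (s : ℤ) • unitVec κ)
        = (L : R) * (∑ l, m κ l * (y l : R))
          + affine m c κ ((L : ℤ) • (0 : Site d) + toSite b + (s : ℤ) • unitVec κ) := by
    intro b s
    rw [add_assoc, affine_apply_smul_add, add_assoc, affine_apply_smul_add]
    simp
  -- `#box = L^d` (the same count is `Literature.Algebra.EuclideanLattices.Regev2004.card_box`; kept local here to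
  -- avoid an unrelated import)
  have hcard : (box d L).card = L ^ d := by
    simp [box, Fintype.card_piFinset, Finset.card_range, Finset.prod_const, Finset.card_univ, Fintype.card_fin]
  simp only [contourSum, key, Finset.sum_add_distrib, Finset.sum_const, Finset.card_range, hcard,
    nsmul_eq_mul, Nat.cast_mul, Nat.cast_pow]
  ring

/-- [folklore] AFFINE ↦ AFFINE: the straight-contour sum of the affine 1-form `(m, c)` is the affine 1-form with linear
part `L^(d+2) • m` and constant part its value at `y = 0`. -/
theorem contourSum_affine (L : ℕ) (m : Fin d → Fin d → R) (c : Fin d → R) :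
    contourSum L (affine m c) = affine ((L ^ (d + 2) : ℕ) • m) (fun κ => contourSum L (affine m c) κ 0) := by
  funext κ y
  rw [contourSum_affine_apply]
  simp only [affine, Pi.smul_apply, nsmul_eq_mul, Nat.cast_pow, Nat.cast_mul, Finset.mul_sum]
  congr 1
  refine Finset.sum_congr rfl fun l _ => ?_
  ring

/-! ## §4 The three facts bundled -/

/-- [folklore] (KKT-alg) of the cell record, kernel form: for EVERY affine 1-form `A = affine m c`, every `L` and every
operator `Rop` on 0-forms annihilating constants — (i) zero Euler–Lagrange term `curvAdj (curv A) = 0` (stationarity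
of `½ Σ|curv A|²` with zero multipliers), (ii) gauge constraint `Rop (codiff₁ A) = 0`, (iii) the straight-contour block
sum of `A` is again affine (linear part `L^(d+2) • m`).  Uniqueness of minimisers is NOT asserted. -/
theorem affine_KKT (Rop : Form0 d R → Form0 d R) (hR : ∀ t : R, Rop (fun _ => t) = 0)
    (m : Fin d → Fin d → R) (c : Fin d → R) (L : ℕ) :
    curvAdj (curv (affine m c)) = 0 ∧ Rop (codiff₁ (affine m c)) = 0 ∧
      contourSum L (affine m c) = affine ((L ^ (d + 2) : ℕ) • m) (fun κ => contourSum L (affine m c) κ 0) :=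
  ⟨curvAdj_curv_affine m c, gauge_constraint_affine Rop hR m c, contourSum_affine L m c⟩

/-! ## §5 Kernel witnesses (`decide`) -/

/-- [folklore] Witness datum: the quadratic 1-form on `ℤ²` with `A₀(x) = x₁²`, `A₁ = 0`. -/
def quadForm : Form1 2 ℤ := fun κ x => if κ = 0 then x 1 ^ 2 else 0

/-- [folklore] The Euler–Lagrange statement of §2 is NOT vacuous: for the (non-affine) quadratic 1-form `quadForm`
the Euler–Lagrange term is `−4 ≠ 0` at the origin, direction `0`. -/
theorem witness_EL_nonzero : curvAdj (curv quadForm) 0 0 = -4 := by decide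

/-- [folklore] Numerical instance of `contourSum_affine`: `d = 1`, `L = 2`, `m = 3`, `c = 5`, coarse point `y = 1`:
`Σ_{b,s∈{0,1}} (3·(2 + b + s) + 5) = 56 = 24·1 + 32` with `24 = L^(d+2)·m` and `32` the value at `y = 0`. -/
theorem example_contourSum :
    contourSum 2 (affine (d := 1) (fun _ _ => (3 : ℤ)) (fun _ => 5)) 0 (fun _ => 1) = 56 ∧
    contourSum 2 (affine (d := 1) (fun _ _ => (3 : ℤ)) (fun _ => 5)) 0 (fun _ => 0) = 32 := by decide

end Literature.MathematicalPhysics.QuantumFieldTheory.Balaban1983to89.Beta.AffineAveraging
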